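import Literature.IUT.LogThetaLattice.BiCoresOfKits
import Literature.IUT.LogThetaLattice.BiCoresRealifiedDFunctor
import HarnessLib

/-!
# [IUTchIII] Thm 1.5 (v) AT THE REAL FRAME `StripFrame.ofKits`: the bi-coric data `BiCoricData.ofKits` whose `D^⊩(−)` READS AS
# the functor of [IUTchII] Cor 4.5 (ii) satisfy «induce AN isomorphism» — proof-only

abc-iut cell (D-0067 wave 4), seat abc-iut-w4-d009 (gen 2; holder of record of GAP row G-w4d009-1); proof-only, 0 defs. Composition BY NAME of
three landed pieces: abc-iut-L6-t3's kit-level assembly `BiCoricData.ofKits L hbij hsurj hR X Bk` (BiCoresOfKits.lean: `realified := liftF Bk.realified`,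
`RFrob := AsSmall Bk.RFrob`), abc-iut-w4-d005's bridge `BiCoricData.thm15vSingleIso_of_realifiedD` / `…_of_frobPreserving` (BiCoresRealifiedDFunctor.lean)
and this seat's functor `realifiedD` / category `RlfData` (RealifiedDFunctor.lean, RealifiedDataDegreeTorsor.lean). S. Mochizuki, *Inter-universal
Teichmüller theory III*, kurims (May 2020) Thm 1.5 (v) p.50: «induce [cf. [IUTchII], Corollaries 4.5, (ii); 4.10, (v)] an isomorphism of collections
of data» [claim: Mochizuki2012, status: disputed]. STATEMENT PROVED HERE: for EVERY kit datum `Bk : BiCoricKit X` whose kit-level `D^⊩(−)`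
(`Bk.realified : M.DMono ⥤ Bk.RFrob`), read through a FAITHFUL functor `U₀ : Bk.RFrob ⥤ RlfData V`, is naturally isomorphic to
`Φ₀ ⋙ realifiedD line c hc` (the functorial algorithm of [IUTchII] Cor 4.5 (ii) in coordinates), the named Prop `Thm15vSingleIso` and the consumer
hypothesis `RealifiedRigidAt` HOLD for the real frame's `BiCoricData.ofKits … Bk` — no hypothesis beyond the kit inputs by name. (The category
`RlfData.{uV,w} V : Type (max uV (w+1))` cannot literally BE the field `Bk.RFrob : Type u` for every `u`, whence the faithful-reading form; when
`u` permits, `U₀ := 𝟭`.) HONEST FRAMING: bookkeeping over landed interfaces; nothing asserts a disputed claim; no side on [IUTchIII] Cor 3.12.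
-/

namespace Literature.IUT.LogThetaLattice

open CategoryTheory
open Literature.IUT.HodgeTheaters Literature.IUT.HodgeTheaters.PMBaseKit Literature.IUT.HodgeArakelov
open Literature.AnabelianGeometry.AbsoluteAnabelian AsSmallTransport

universe u w u₁ v₁ u₂

variable {l : ℕ} {K : PMBaseKit.{u} l} {M : K.MultKit} {FK : K.FKit M}
  (L : FK.MonoLaws) (hbij : FK.IsomFtoDBijective) (hsurj : FK.IsomFmtoDmSurjective) (hR : FK.RlfOfIsStrip)
  (X : TimesMuSide FK L) (Bk : BiCoricKit X)
  {Vx : Type u₂} {𝒟 : Type u₁} [Category.{v₁} 𝒟]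

/-- The reading of the real frame's `realified = liftF Bk.realified` through `AsSmall.down ⋙ U₀` IS (naturally isomorphic to)
`(AsSmall.down ⋙ Φ₀) ⋙ realifiedD` when the kit-level one is. [claim: Mochizuki2012, status: disputed] -/
noncomputable def ofKitsRealifiedReadingIso (line : 𝒟 → Vx → RLine.{w}) (c : Vx → ℝ) (hc : ∀ v, 0 < c v)
    (Φ₀ : M.DMono ⥤ 𝒟) (U₀ : Bk.RFrob ⥤ RlfData.{u₂, w} Vx) [U₀.Faithful]
    (η₀ : Bk.realified ⋙ U₀ ≅ Φ₀ ⋙ realifiedD line c hc) :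
    (BiCoricData.ofKits L hbij hsurj hR X Bk).realified ⋙ (AsSmall.down ⋙ U₀) ≅
      (AsSmall.down ⋙ Φ₀) ⋙ realifiedD line c hc :=
  NatIso.ofComponents (fun A => η₀.app (AsSmall.down.obj A))
    (fun f => η₀.hom.naturality (AsSmall.down.map f))

/-- `AsSmall.down` is faithful (morphisms of `AsSmall C` are lifts of morphisms of `C`). [folklore] -/
private theorem asSmallDown_faithful (C : Type u₁) [Category.{v₁} C] : (AsSmall.down : AsSmall.{w} C ⥤ C).Faithful :=
  ⟨fun h => ULift.ext _ _ h⟩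

/-- **IUTchIII:Thm1.5(v)** (kurims p.50) AT THE REAL FRAME: `Thm15vSingleIso` holds for `BiCoricData.ofKits … Bk` whenever the kit's `D^⊩(−)` reads,
through faithful coordinates, as the functor of [IUTchII] Cor 4.5 (ii). [claim: Mochizuki2012, status: disputed] -/
theorem thm15vSingleIso_ofKits_of_realifiedD (line : 𝒟 → Vx → RLine.{w}) (c : Vx → ℝ) (hc : ∀ v, 0 < c v)
    (Φ₀ : M.DMono ⥤ 𝒟) (U₀ : Bk.RFrob ⥤ RlfData.{u₂, w} Vx) [U₀.Faithful]
    (η₀ : Bk.realified ⋙ U₀ ≅ Φ₀ ⋙ realifiedD line c hc) :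
    (BiCoricData.ofKits L hbij hsurj hR X Bk).Thm15vSingleIso :=
  have hF : (AsSmall.down ⋙ U₀ : AsSmall.{max 1 u} Bk.RFrob ⥤ RlfData.{u₂, w} Vx).Faithful :=
    @Functor.Faithful.comp _ _ _ _ _ _ AsSmall.down U₀ (asSmallDown_faithful Bk.RFrob) inferInstance
  @BiCoricData.thm15vSingleIso_of_realifiedD _ (BiCoricData.ofKits L hbij hsurj hR X Bk) _ _ _ line c hc
    (AsSmall.down ⋙ Φ₀) (AsSmall.down ⋙ U₀) hF (ofKitsRealifiedReadingIso L hbij hsurj hR X Bk line c hc Φ₀ U₀ η₀)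

/-- **IUTchII:Cor4.10(v)** (kurims p.160) AT THE REAL FRAME: the consumer hypothesis `RealifiedRigidAt` (F-2066) at every pair of
`D^⊢`-prime-strips of `StripFrame.ofKits`, under the same reading. [claim: Mochizuki2012, status: disputed] -/
theorem realifiedRigidAt_ofKits_of_realifiedD (line : 𝒟 → Vx → RLine.{w}) (c : Vx → ℝ) (hc : ∀ v, 0 < c v)
    (Φ₀ : M.DMono ⥤ 𝒟) (U₀ : Bk.RFrob ⥤ RlfData.{u₂, w} Vx) [U₀.Faithful]
    (η₀ : Bk.realified ⋙ U₀ ≅ Φ₀ ⋙ realifiedD line c hc)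
    (A B : (StripFrame.ofKits L hbij hsurj hR X).Dv) :
    (BiCoricData.ofKits L hbij hsurj hR X Bk).RealifiedRigidAt A B :=
  have hF : (AsSmall.down ⋙ U₀ : AsSmall.{max 1 u} Bk.RFrob ⥤ RlfData.{u₂, w} Vx).Faithful :=
    @Functor.Faithful.comp _ _ _ _ _ _ AsSmall.down U₀ (asSmallDown_faithful Bk.RFrob) inferInstance
  @BiCoricData.realifiedRigidAt_of_realifiedD _ (BiCoricData.ofKits L hbij hsurj hR X Bk) _ _ _ line c hc
    (AsSmall.down ⋙ Φ₀) (AsSmall.down ⋙ U₀) hF (ofKitsRealifiedReadingIso L hbij hsurj hR X Bk line c hc Φ₀ U₀ η₀) A B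

end Literature.IUT.LogThetaLattice
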